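import Literature.AlgebraicGeometry.HodgeTheory.SimpleThreefoldCMEmbeddingCaseF
import Literature.AlgebraicGeometry.HodgeTheory.MoonenZarhinCaseFHodgeConjecture
import Literature.AlgebraicGeometry.HodgeTheory.RankOneCentreTimesCMCurveProductSpan
import Summits.HodgeConjecture.HodgeConjecture.Theorems.Ring2ClassTargets
import HarnessLib

/-!
# The Hodge conjecture for EVERY complex abelian fivefold of Moonen–Zarhin's case (f), from HC_CM and the Weil classes of abelian fourfolds

Cell `pub-hodge-ring2` (HONEST FRAMING: research route conditional on HC_CM; not a corollary; Q11.4-sentence-2 already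
refuted in dim ≥ 3), Literature lane (lit seat, generation 63, programme R34). NEW as stated — a CONDITIONAL theorem
combining published results —, hence under `Summits/`. Theorems only (no definition, no named fact, no `sorry`). Both
conditions are explicit HYPOTHESES of the theorems below, never facts: `hCM : ∀ B, CMHodgeHypothesisAt B` (HC_CM, the
Hodge conjecture for complex abelian varieties of CM type, Milne's per-variety form = the cell's binder) and
`hMark : Markman2025_weilClasses_algebraic_abelianFourfold` (the tree's EXISTING named fact: algebraicity of the Weil
classes of abelian fourfolds; not discharged, not restated).

Moonen–Zarhin, Math. Ann. **315** (1999), case (f) (chunk p0001 L132–L134 [corpus: paper:arxiv-math_9901113]): «`X` is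
isogenous to a product `X_0 × X_1 × X_2`, where `X_0` is an elliptic curve, where `X_1` and `X_2` are as in (a) [`X_1`
an elliptic curve with complex multiplication by an imaginary quadratic field `k`, `X_2` a simple abelian threefold
such that there exists an embedding `k ↪ End⁰(X_2)`], and such that `X_0` and `X_1` are not isogenous»; Thm. 0.2 (2):
«`Hg(X) = Hg(X_0) × Hg(X_1 × X_2)` … `B•(X)` is generated by the divisor classes `D•(X)` together with the pull-backs
of the Weil classes in `W_k ⊂ B²(X_1 × X_2)`»; §5 (5.3): «Either (a1) `F = k`, or (a2) `F` is a sextic CM-field»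
(`F = End⁰(X_2)`).

THE ASSEMBLY. For `X₀`, `E` elliptic curves, `X₀ ≁ E`, `E` of CM type, `T` a simple threefold with a ring homomorphism
`End⁰(E) →+* End⁰(T)` (the cell's spelling of (a), as in `Ring2/NonSimpleFivefoldsComplete`):
* (a2) `T` of CM type ⟹ `E × T` is of CM type, so HC_CM gives `HC(E × T)`, and Thm. 0.2 (2) (product span, the
  Literature theorem `hodgeConjectureFor_caseF_of_odd_of_hodgeConjectureFor` with its centre hypothesis discharged by
  `End⁰(T)` commutative, lit g63 R33) gives `HC(X₀ × E × T)` — `hodgeConjectureFor_caseF_of_isOfCMType_of_cmHodgeHypothesis`;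
* (a1) `dim_ℚ End⁰(T) = 2` ⟹ the Literature theorem `hodgeConjectureFor_caseF_of_weilClassesFourfold` (R31-E: HC modulo
  the Weil classes of the fourfold `T × E`) applies once its data are PRODUCED from the embedding: an honest
  `φ : T ⟶ T` with `φ ≫ φ = -(M²d₁) = (Mχ₁) ≫ (Mχ₁)` (`exists_hom_comp_self_eq_neg_of_ringHom`), multiplicities
  `(2,1)`/`(1,2)` of `φ` on `H^{1,0}(T)` (Shimura Prop. 14: both positive on a simple `T`, sum `3`) and the sign of the
  curve's complex multiplication chosen to match (`eigenMultiplicity_neg`) —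
  `hodgeConjectureFor_caseF_of_finrank_eq_two_of_weilClassesFourfold`;
* (5.3) `dim_ℚ End⁰(T) = 2` or `T` of CM type (`finrank_endAlgebra_eq_two_or_isOfCMType_of_dim_eq_three_of_ringHom`,
  lit g63 R33-C), whence **`hodgeConjectureFor_caseF`**, **`hodgeConjectureFor_of_isIsogenous_caseF`** (every `X`
  isogenous to `X₀ × E × T`) and the class target **`hcOnClass_caseF_of_cmHodgeHypothesis_of_weilClassesFourfold`**, with
  its on-path lemma `hcOnClass_caseF_of_hodgeConjecture`.
What is NOT claimed: nothing about `D²(X) ≠ B²(X)`; no discharge of either hypothesis; case (e) (`X₁² × X₂`) is not here.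

## References
* [MoonenZarhin1999LowDim] B. Moonen, Yu. Zarhin, Math. Ann. 315 (1999) 711–733: cases (a)/(f), Thm. 0.2 (2), §5 (5.3),
  (5.12) [corpus: paper:arxiv-math_9901113 p0001, p0008–p0011]. [cite: MoonenZarhin1999LowDim, Thm. 0.2 (2) with case (f)]
* [Milne1999] J. S. Milne, Compositio Math. 117 (1999), §7 (the hypothesis HC_CM), §2 p. 54. [cite: Milne1999, §7 p. 72]
* [Markman2025SurveySecant] E. Markman, arXiv:2509.23403, Thm. 1.2 (Weil classes on abelian fourfolds).
  [claim: Markman2025SurveySecant, status: under-review]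
* [vanGeemen1994HodgeAV] B. van Geemen, LNM 1594 (1994), Lemma 3.7 (isogeny invariance). [cite: vanGeemen1994HodgeAV, Lemma 3.7]
-/

noncomputable section

open CategoryTheory CategoryTheory.Limits

namespace Summit.HodgeConjecture.Ring2.CaseF

open Literature.AlgebraicGeometry.Motives (AbelianVariety)
open Literature.AlgebraicGeometry.Motives.AbelianVariety
open Literature.AlgebraicGeometry.HodgeTheory
open Literature.AlgebraicGeometry.ComplexMultiplication
open Literature.AlgebraicGeometry.Milne1999
open Summit.HodgeConjecture.HodgeConjecture.Ring2.ClassTargets (HCOnClass)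

variable {X₀ X₁ X₂ : AbelianVariety ℂ}

/-! ### §1 Sub-case (a2): `X₂` of CM type — HC_CM suffices -/

/-- **Case (f), sub-case (a2) (`X₂` of CM type), from HC_CM.** `X₀`, `X₁` elliptic curves, `X₀ ≁ X₁`, `X₁` with
complex multiplication `χ₁ ≫ χ₁ = -d₁`, `X₂` a simple threefold OF CM TYPE with an embedding
`j : End⁰(X₁) →+* End⁰(X₂)`; `hCM` = HC_CM (hypothesis). Then the Hodge conjecture holds for `X₀ × (X₁ × X₂)`:
`X₁ × X₂` is of CM type, so `hCM` gives `HC(X₁ × X₂)`; Moonen–Zarhin's product span for case (f) (Literature, with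
the centre hypothesis automatic for a simple threefold) and `B(X₀) = D(X₀)` for the curve do the rest.
[cite: MoonenZarhin1999LowDim, Thm. 0.2 (2) with case (f)] [cite: Milne1999, §7 p. 72] -/
theorem hodgeConjectureFor_caseF_of_isOfCMType_of_cmHodgeHypothesis
    (hCM : ∀ B : AbelianVariety ℂ, CMHodgeHypothesisAt B)
    (hX₀ : X₀.dim = 1) (hX₁ : X₁.dim = 1) (hni : ¬ AbelianVariety.IsIsogenous X₀ X₁) (χ₁ : X₁ ⟶ X₁) {d₁ : ℕ}
    (hd₁ : 0 < d₁) (hχ₁ : χ₁ ≫ χ₁ = -(d₁ • 𝟙 X₁)) (hX₂ : X₂.IsSimple) (hX₂3 : X₂.dim = 3)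
    (j : X₁.endAlgebra →+* X₂.endAlgebra) (hcm : IsOfCMType X₂) :
    HodgeConjectureFor (X₀.prod (X₁.prod X₂)).dim (X₀.prod (X₁.prod X₂)).X := by
  obtain ⟨w, hw, hww⟩ := exists_center_mul_self_eq_neg_of_ringHom (X₂ := X₂) hχ₁
    (j.codRestrict (Subalgebra.center ℚ X₂.endAlgebra).toSubring.toSubsemiring
      fun x => ringHom_apply_mem_center_endAlgebra_of_dim_eq_three hX₂ hX₂3 j x)
  have h12 : HodgeConjectureFor (X₁.prod X₂).dim (X₁.prod X₂).X :=
    hCM (X₁.prod X₂) isSmoothProjective_holds ((isOfCMType_of_hom_comp_self_eq_neg hX₁ hd₁ hχ₁).prod hcm)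
  exact hodgeConjectureFor_caseF_of_odd_of_hodgeConjectureFor hX₀ hX₁ hni χ₁ hd₁ hχ₁ hX₂ (by rw [hX₂3]; decide)
    (by omega) hw hww h12

/-! ### §2 Sub-case (a1): `End⁰(X₂) = k` — the Weil classes of the fourfold `X₂ × X₁` suffice -/

/-- **Case (f), sub-case (a1) (`dim_ℚ End⁰(X₂) = 2`), from the algebraicity of the Weil classes of abelian fourfolds.**
Same data, now with `dim_ℚ End⁰(X₂) = 2`; `hMark` = the tree's named fact `Markman2025_weilClasses_algebraic_abelianFourfold`
(hypothesis). The Literature theorem `hodgeConjectureFor_caseF_of_weilClassesFourfold` (Thm. 0.2 (2) sentence 3 read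
for HC) needs an endomorphism `φ` of `X₂` and a complex multiplication of `X₁` with the SAME square `-d` and multiplicity
`1` at the same eigenvalue `μ₀`; they are produced here: `φ ≫ φ = -(M²d₁) = (Mχ₁) ≫ (Mχ₁)` by clearing the denominator
of `j(χ₁)`, `φ` has multiplicities `{1, 2}` on `H^{1,0}(X₂)` (both positive on a simple threefold — Shimura's
Proposition 14, the tree's `eigenMultiplicity_pos_of_isSimple` —, sum `3`), and `± Mχ₁` has multiplicity `1` at the
eigenvalue where `φ` has multiplicity `1`. [cite: MoonenZarhin1999LowDim, Thm. 0.2 (2) with case (f) and §5 (5.3)]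
[claim: Markman2025SurveySecant, status: under-review] -/
theorem hodgeConjectureFor_caseF_of_finrank_eq_two_of_weilClassesFourfold
    (hMark : Markman2025_weilClasses_algebraic_abelianFourfold)
    (hX₀ : X₀.dim = 1) (hX₁ : X₁.dim = 1) (hni : ¬ AbelianVariety.IsIsogenous X₀ X₁) (χ₁ : X₁ ⟶ X₁) {d₁ : ℕ}
    (hd₁ : 0 < d₁) (hχ₁ : χ₁ ≫ χ₁ = -(d₁ • 𝟙 X₁)) (hX₂ : X₂.IsSimple) (hX₂3 : X₂.dim = 3)
    (j : X₁.endAlgebra →+* X₂.endAlgebra) (h2 : Module.finrank ℚ X₂.endAlgebra = 2) :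
    HodgeConjectureFor (X₀.prod (X₁.prod X₂)).dim (X₀.prod (X₁.prod X₂)).X := by
  obtain ⟨φ, M, hM, hφ, hχ, -⟩ := exists_hom_comp_self_eq_neg_of_ringHom hχ₁ j
  have hd : 0 < M ^ 2 * d₁ := Nat.mul_pos (pow_pos hM 2) hd₁
  -- multiplicities of `φ` on `X₂`: positive, summing to `3`
  have hsum := eigenMultiplicity_add_eigenMultiplicity_neg_eq_dim X₂ φ hd hφ
  rw [hX₂3] at hsum
  obtain ⟨ha, hb⟩ := AbelianVariety.eigenMultiplicity_pos_of_isSimple X₂ hX₂ φ hd hφ (by omega)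
  -- multiplicities of `M χ₁` on the curve `X₁`: summing to `1`
  have hsum₁ := eigenMultiplicity_add_eigenMultiplicity_neg_eq_dim X₁ (M • χ₁) hd hχ
  rw [hX₁] at hsum₁
  have hχ' : (-(M • χ₁)) ≫ (-(M • χ₁)) = -((M ^ 2 * d₁) • 𝟙 X₁) := by
    rw [Preadditive.neg_comp, Preadditive.comp_neg, neg_neg, hχ]
  -- given an eigenvalue `μ₀` of multiplicity `1` for `φ`, match the curve's sign and conclude
  have key : ∀ μ₀ : ℂ, (μ₀ = Complex.I * (Real.sqrt (M ^ 2 * d₁ : ℕ) : ℂ) ∨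
      μ₀ = -(Complex.I * (Real.sqrt (M ^ 2 * d₁ : ℕ) : ℂ))) → eigenMultiplicity X₂ φ μ₀ = 1 →
      eigenMultiplicity X₁ (M • χ₁) μ₀ + eigenMultiplicity X₁ (M • χ₁) (-μ₀) = 1 →
      HodgeConjectureFor (X₀.prod (X₁.prod X₂)).dim (X₀.prod (X₁.prod X₂)).X := by
    intro μ₀ hμ₀ hm₂ hs₁
    rcases Nat.eq_zero_or_pos (eigenMultiplicity X₁ (M • χ₁) μ₀) with h0 | hpos
    · have hm₁ : eigenMultiplicity X₁ (-(M • χ₁)) μ₀ = 1 := by rw [eigenMultiplicity_neg]; omega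
      exact hodgeConjectureFor_caseF_of_weilClassesFourfold hMark hX₀ hX₁ hni hX₂ hX₂3 h2 φ hd hφ hμ₀ hm₂
        (-(M • χ₁)) hχ' hm₁
    · have hm₁ : eigenMultiplicity X₁ (M • χ₁) μ₀ = 1 := by omega
      exact hodgeConjectureFor_caseF_of_weilClassesFourfold hMark hX₀ hX₁ hni hX₂ hX₂3 h2 φ hd hφ hμ₀ hm₂ (M • χ₁) hχ
        hm₁
  rcases (show eigenMultiplicity X₂ φ (Complex.I * (Real.sqrt (M ^ 2 * d₁ : ℕ) : ℂ)) = 1 ∨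
      eigenMultiplicity X₂ φ (-(Complex.I * (Real.sqrt (M ^ 2 * d₁ : ℕ) : ℂ))) = 1 by omega) with h1 | h1
  · exact key _ (Or.inl rfl) h1 hsum₁
  · exact key _ (Or.inr rfl) h1 (by rw [neg_neg, add_comm]; exact hsum₁)

/-! ### §3 Case (f), all of it -/

/-- **THE HODGE CONJECTURE FOR `X₀ × X₁ × X₂` IN MOONEN–ZARHIN'S CASE (f), GIVEN HC_CM AND THE WEIL CLASSES OF ABELIAN
FOURFOLDS.** `X₀`, `X₁` elliptic curves, «`X_0` and `X_1` are not isogenous», `X₁` with complex multiplication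
`χ₁ ≫ χ₁ = -d₁` (`d₁ > 0`), `X₂` a simple abelian threefold and «an embedding `k ↪ End⁰(X_2)`» as a ring homomorphism
`j : End⁰(X₁) →+* End⁰(X₂)`. Hypotheses: `hCM` (HC_CM) — used only when `X₂` is of CM type ((a2)); `hMark` (the named
fact `Markman2025_weilClasses_algebraic_abelianFourfold`) — used only when `End⁰(X₂) = k` ((a1)); the dichotomy is
Moonen–Zarhin's (5.3) (`finrank_endAlgebra_eq_two_or_isOfCMType_of_dim_eq_three_of_ringHom`).
[cite: MoonenZarhin1999LowDim, Thm. 0.2 (2) with case (f) and §5 (5.3)] [cite: Milne1999, §7 p. 72]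
[claim: Markman2025SurveySecant, status: under-review] -/
theorem hodgeConjectureFor_caseF (hCM : ∀ B : AbelianVariety ℂ, CMHodgeHypothesisAt B)
    (hMark : Markman2025_weilClasses_algebraic_abelianFourfold)
    (hX₀ : X₀.dim = 1) (hX₁ : X₁.dim = 1) (hni : ¬ AbelianVariety.IsIsogenous X₀ X₁) (χ₁ : X₁ ⟶ X₁) {d₁ : ℕ}
    (hd₁ : 0 < d₁) (hχ₁ : χ₁ ≫ χ₁ = -(d₁ • 𝟙 X₁)) (hX₂ : X₂.IsSimple) (hX₂3 : X₂.dim = 3)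
    (j : X₁.endAlgebra →+* X₂.endAlgebra) :
    HodgeConjectureFor (X₀.prod (X₁.prod X₂)).dim (X₀.prod (X₁.prod X₂)).X := by
  rcases finrank_endAlgebra_eq_two_or_isOfCMType_of_dim_eq_three_of_ringHom hX₂ hX₂3 hd₁ hχ₁ j with h2 | hcm
  · exact hodgeConjectureFor_caseF_of_finrank_eq_two_of_weilClassesFourfold hMark hX₀ hX₁ hni χ₁ hd₁ hχ₁ hX₂ hX₂3 j h2
  · exact hodgeConjectureFor_caseF_of_isOfCMType_of_cmHodgeHypothesis hCM hX₀ hX₁ hni χ₁ hd₁ hχ₁ hX₂ hX₂3 j hcm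

/-- **Case (f) EXACTLY AS PRINTED, in the cell's vocabulary**: every complex abelian variety `X` isogenous to a product
`X₀ × E × T` with `X₀`, `E` elliptic curves, `E` of CM type, `X₀ ≁ E`, `T` a simple threefold and
`Nonempty (End⁰(E) →+* End⁰(T))` satisfies the Hodge conjecture — GIVEN HC_CM and the Weil classes of abelian fourfolds
(the complex multiplication of `E` from the tree's `exists_hom_comp_self_eq_neg_of_cmCurve`; isogeny invariance of the
Hodge conjecture, van Geemen Lemma 3.7). [cite: MoonenZarhin1999LowDim, Thm. 0.2 (2) with case (f)]
[cite: vanGeemen1994HodgeAV, Lemma 3.7] [cite: Milne1999, §7 p. 72] [claim: Markman2025SurveySecant, status: under-review] -/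
theorem hodgeConjectureFor_of_isIsogenous_caseF (hCM : ∀ B : AbelianVariety ℂ, CMHodgeHypothesisAt B)
    (hMark : Markman2025_weilClasses_algebraic_abelianFourfold) {X E T : AbelianVariety ℂ}
    (hX : AbelianVariety.IsIsogenous X (X₀.prod (E.prod T))) (hX₀ : X₀.dim = 1) (hE : E.dim = 1)
    (hEcm : IsOfCMType E) (hni : ¬ AbelianVariety.IsIsogenous X₀ E) (hT : T.IsSimple) (hT3 : T.dim = 3)
    (hj : Nonempty (E.endAlgebra →+* T.endAlgebra)) : HodgeConjectureFor X.dim X.X := by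
  obtain ⟨j⟩ := hj
  obtain ⟨χ, d, hd, hχ⟩ := exists_hom_comp_self_eq_neg_of_cmCurve hE hEcm
  exact HodgeConjectureFor.of_isIsogenous hX (hodgeConjectureFor_caseF hCM hMark hX₀ hE hni χ hd hχ hT hT3 j)

/-- **Class target `HC_{case (f)}` of HC_CM ∧ (Weil classes of abelian fourfolds)**: the Hodge conjecture on the class
of complex abelian varieties isogenous to some `X₀ × E × T` of case (f) (`X₀`, `E` elliptic curves, `E` of CM type,
`X₀ ≁ E`, `T` a simple threefold with `End⁰(E) ↪ End⁰(T)`). The complement of this class inside «non-simple fivefolds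
with a case-(a) pair of factors» is case (e) (`X₁² × X₂`), not treated here.
[cite: MoonenZarhin1999LowDim, Thm. 0.2 (2) with case (f)] [cite: Deligne2000, §1] -/
theorem hcOnClass_caseF_of_cmHodgeHypothesis_of_weilClassesFourfold
    (hCM : ∀ B : AbelianVariety ℂ, CMHodgeHypothesisAt B) (hMark : Markman2025_weilClasses_algebraic_abelianFourfold) :
    HCOnClass fun X => ∃ X₀ E T : AbelianVariety ℂ, X₀.dim = 1 ∧ E.dim = 1 ∧ IsOfCMType E ∧
      ¬ AbelianVariety.IsIsogenous X₀ E ∧ T.IsSimple ∧ T.dim = 3 ∧ Nonempty (E.endAlgebra →+* T.endAlgebra) ∧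
      AbelianVariety.IsIsogenous X (X₀.prod (E.prod T)) :=
  fun _ ⟨_, _, _, hX₀, hE, hEcm, hni, hT, hT3, hj, hX⟩ =>
    hodgeConjectureFor_of_isIsogenous_caseF hCM hMark hX hX₀ hE hEcm hni hT hT3 hj

/-- **On path**: the Hodge conjecture (summit form, all smooth projective complex varieties) gives the class target —
so `HC_{case (f)}` is a CASE of the summit, reduced above to HC_CM and the fourfold Weil classes. [cite: Deligne2000, §1] -/
theorem hcOnClass_caseF_of_hodgeConjecture
    (h : ∀ ⦃n : ℕ⦄ ⦃Y : Literature.AlgebraicGeometry.Motives.SchemeOver ℂ⦄,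
      Literature.AlgebraicGeometry.Motives.IsSmoothProjective n Y → HodgeConjectureFor n Y) :
    HCOnClass fun X => ∃ X₀ E T : AbelianVariety ℂ, X₀.dim = 1 ∧ E.dim = 1 ∧ IsOfCMType E ∧
      ¬ AbelianVariety.IsIsogenous X₀ E ∧ T.IsSimple ∧ T.dim = 3 ∧ Nonempty (E.endAlgebra →+* T.endAlgebra) ∧
      AbelianVariety.IsIsogenous X (X₀.prod (E.prod T)) :=
  fun _ _ => h isSmoothProjective_holds

end Summit.HodgeConjecture.Ring2.CaseF

end
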